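import Literature.Probability.RandomPlanarGeometry.LoewnerImageStep
import Literature.Probability.RandomPlanarGeometry.RestrictionMapReflection
import Literature.Probability.RandomPlanarGeometry.LoewnerPointFlow
import Literature.Analysis.Complex.KoebeQuarterProofs
import Literature.Analysis.Complex.KoebeDistortion
import Literature.Analysis.Complex.HydrodynamicCapacity
import Mathlib.Analysis.Complex.Liouville
import HarnessLib

/-!
# One step of the conformal image of a Loewner chain, II: the identity on the circle `|z| = ρ`

Sequel to `LoewnerImageStep` (notation and hypotheses there: `B ∈ 𝒬*` missing `B(0, 8ρ₀)`,
`h = hmap Φ = E_B - L`, the increment driver `U` run for time `u` with size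
`η = stepSize S u`, the slid hull `B'`, `h' = hmapT Φ' (U_u)`, `g = g_u`, and the reflected map
`φ = phiStep Φ Φ' (2η) = h' ∘ g ∘ h⁻¹`, hydrodynamically normalized at `w₀ = -L`). Here we add
the restriction derivative `d = Φ'_B(0) = E_B'(0)` and prove the pointwise identity on the circles
`|ζ| = ρ`, `ρ₀/2 ≤ ρ ≤ ρ₀`, behind Lawler's Prop. 4.40 ([LSW] (5.2)):

  `h'(ζ) - h(ζ) = a/E_B(ζ) - h''(ζ)·(2u/ζ) + O(a η + u η + u²)`,   `a = hcapAt φ w₀`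

(`sub_hmap_circle_bound`), from four ingredients, all proved here:

* **Koebe**: `E_B` is injective on `B(0, 4ρ₀)` (`injOn_hullExt_ball`, the univalent reflection of
  `RestrictionMapReflection` + identity theorem) and **`|E_B(z)| ≥ d ρ/4` for `ρ ≤ |z| < 4ρ₀`**
  (`norm_hullExt_ge`, Koebe's one-quarter theorem `koebeQuarter_holds` on `B(0, ρ)`);
* **Loewner**: `|g(ζ) - ζ - 2u/ζ| ≤ 16 u η/ρ₀²` for `|ζ| ≥ ρ₀/2` (`norm_map_sub_sub_div_le`, the
  integrated Loewner equation `LoewnerPointFlow.map_eq_add_integral`, Lawler (4.15)-style);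
* **Taylor**: `|h'(g ζ) - h'(ζ) - h''(ζ)(g ζ - ζ)| ≤ (2/ρ₀)|g ζ - ζ|²` (`norm_hmapT_taylor_le`, mean
  value inequality twice, with `|E_{B'}'| ≤ 2`, `|E_{B'}''| ≤ 2/ρ₀` near `0` by Schwarz–Pick and a
  Cauchy estimate);
* **the expansion of `φ`** (`IsHydrodynamicAt.norm_sub_sub_div_le'` of `HydrodynamicCapacity`,
  Lawler's Prop. 3.46) at `w = h(ζ)`, `w - w₀ = E_B(ζ)`, combined with the conjugation identity
  `φ(h ζ) = h'(g ζ)` of `LoewnerImageStep`.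

## References

* G. F. Lawler, *Conformally Invariant Processes in the Plane* (2005), §4.6.1 Prop. 4.40 and its
  proof; Prop. 3.46; Thm. 3.17 (Koebe 1/4) [Lawler2005].
* G. F. Lawler, O. Schramm, W. Werner, *Conformal restriction: the chordal case* (2003), §5
  (5.1)–(5.2) [LawlerSchrammWerner2003Restriction].
-/

noncomputable section

open Set Filter Metric Bornology Function
open _root_.Complex _root_.Topology
open UpperHalfPlane (upperHalfPlaneSet isOpen_upperHalfPlaneSet)
open Literature.Analysis.Complex (schwarzExt IsHydrodynamicAt hcapAt)
open scoped ComplexConjugate NNReal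

namespace Literature.Probability.RandomPlanarGeometry

namespace Loewner

variable {B : Set ℂ} {Φ : ConformalEquiv (upperHalfPlaneSet \ B) upperHalfPlaneSet} {d ρ₀ : ℝ}

/-! ### Koebe: injectivity of `E_B` near `0` and the lower bound `|E_B(z)| ≥ d|z|/4` -/

section Koebe

variable (hB : IsStarHull B) (hΦ : IsRestrictionMap B Φ) (hd : HasRestrictionDeriv B Φ d)
  (hρ₀ : 0 < ρ₀) (hBρ : Disjoint (ball (0 : ℂ) (8 * ρ₀)) B)
include hB hΦ hd hρ₀ hBρ

/-- **`E_B` is injective on `B(0, 4ρ₀)`** (the univalent reflection of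
`IsRestrictionMap.exists_reflection` agrees with the global reflection `hullExt Φ` on the ball, by
the identity theorem). [folklore] -/
theorem injOn_hullExt_ball : InjOn (hullExt Φ) (ball (0 : ℂ) (4 * ρ₀)) := by
  have hr : Disjoint (ball (0 : ℂ) (2 * (4 * ρ₀))) B := by
    rw [show 2 * (4 * ρ₀) = 8 * ρ₀ by ring]; exact hBρ
  obtain ⟨F, hFd, hFinj, -, -, hFeq⟩ := hΦ.exists_reflection hB hd (by positivity) hr
  have hsub : ball (0 : ℂ) (4 * ρ₀) ⊆ symmDomain B := by
    have := ball_subset_symmDomain (B := B) (x := 0) (r := 8 * ρ₀) (by simpa using hBρ)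
    rw [ofReal_zero] at this
    exact (ball_subset_ball (by linarith)).trans this
  have h1 : AnalyticOnNhd ℂ (hullExt Φ) (ball 0 (4 * ρ₀)) :=
    ((differentiableOn_hullExt hB.isBoundedHull hΦ).mono hsub).analyticOnNhd isOpen_ball
  have h2 : AnalyticOnNhd ℂ F (ball 0 (4 * ρ₀)) := hFd.analyticOnNhd isOpen_ball
  set z₁ : ℂ := I * ((2 * ρ₀ : ℝ) : ℂ) with hz₁
  have hz₁im : 0 < z₁.im := by simp [hz₁, hρ₀]
  have hz₁r : z₁ ∈ ball (0 : ℂ) (4 * ρ₀) := by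
    rw [mem_ball_zero_iff, hz₁, norm_mul, norm_I, one_mul, norm_real, Real.norm_of_nonneg (by positivity)]
    linarith
  have hev : hullExt Φ =ᶠ[𝓝 z₁] F := by
    filter_upwards [(isOpen_upperHalfPlaneSet.inter isOpen_ball).mem_nhds
      ⟨(hz₁im : z₁ ∈ upperHalfPlaneSet), hz₁r⟩] with z hz
    rw [hullExt_of_im_pos hz.1, hFeq hz]
  have heq : EqOn (hullExt Φ) F (ball 0 (4 * ρ₀)) :=
    h1.eqOn_of_preconnected_of_eventuallyEq h2 (convex_ball _ _).isPreconnected hz₁r hev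
  exact hFinj.congr heq.symm

omit hρ₀ hBρ in
/-- `0 < d ≤ 1` for the restriction derivative. [cite: LawlerSchrammWerner2003Restriction, §2 (2.4) p. 7] -/
theorem restrictionDeriv_pos_le_one : 0 < d ∧ d ≤ 1 := by
  obtain ⟨d', hd'0, hd'1, hd'⟩ := IsStarHull.exists_hasRestrictionDeriv_holds hB hΦ
  rw [hd.unique hB hd']
  exact ⟨hd'0, hd'1⟩

/-- `E_B(z) ≠ 0` for `0 ≠ z ∈ B(0, 4ρ₀)` (injectivity, `E_B(0) = 0`). [folklore] -/
theorem hullExt_ne_zero {z : ℂ} (hz : z ∈ ball (0 : ℂ) (4 * ρ₀)) (hz0 : z ≠ 0) : hullExt Φ z ≠ 0 := by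
  intro h
  have h0 : hullExt Φ 0 = 0 := hullExt_zero hB hΦ
  exact hz0 (injOn_hullExt_ball hB hΦ hd hρ₀ hBρ hz (mem_ball_self (by positivity)) (h.trans h0.symm))

/-- **Koebe lower bound `|E_B(z)| ≥ d ρ/4` for `ρ ≤ |z|`, `z ∈ B(0, 4ρ₀)`, `0 < ρ ≤ 4ρ₀`**: by
Koebe's one-quarter theorem on `B(0, ρ)` (where `E_B` is univalent with `E_B(0) = 0`,
`E_B'(0) = d`), `B(0, dρ/4) ⊆ E_B(B(0, ρ))`, and `E_B(z) ∉ E_B(B(0, ρ))` by injectivity on the big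
ball. [cite: Lawler2005, Thm. 3.17 (Koebe 1/4)] -/
theorem norm_hullExt_ge {ρ : ℝ} (hρ : 0 < ρ) (hρ4 : ρ ≤ 4 * ρ₀) {z : ℂ} (hz : z ∈ ball (0 : ℂ) (4 * ρ₀))
    (hρz : ρ ≤ ‖z‖) : d * ρ / 4 ≤ ‖hullExt Φ z‖ := by
  have hinj := injOn_hullExt_ball hB hΦ hd hρ₀ hBρ
  have hsub : ball (0 : ℂ) ρ ⊆ ball (0 : ℂ) (4 * ρ₀) := ball_subset_ball hρ4
  have hsymm : ball (0 : ℂ) (4 * ρ₀) ⊆ symmDomain B := by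
    have := ball_subset_symmDomain (B := B) (x := 0) (r := 8 * ρ₀) (by simpa using hBρ)
    rw [ofReal_zero] at this
    exact (ball_subset_ball (by linarith)).trans this
  have hdiff : DifferentiableOn ℂ (hullExt Φ) (ball (0 : ℂ) ρ) :=
    (differentiableOn_hullExt hB.isBoundedHull hΦ).mono (hsub.trans hsymm)
  -- rescale to the unit disc
  obtain ⟨hFd, hFinj, hFder⟩ := Literature.Analysis.Complex.AreaThm.rescale_ball (c := 0) hρ hdiff (hinj.mono hsub)
  simp only [zero_add] at hFd hFinj hFder
  have hF0 : hullExt Φ ((ρ : ℂ) * 0) = 0 := by simp [hullExt_zero hB hΦ]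
  have hFder0 : deriv (fun ζ : ℂ ↦ hullExt Φ (ρ * ζ)) 0 = ρ * d := by
    rw [hFder 0 (mem_ball_self one_pos), mul_zero, deriv_hullExt_zero hB hΦ hd]
  have hK := Literature.Analysis.Complex.koebeQuarter_holds _ hFd hFinj
  simp only [hF0, hFder0] at hK
  -- `E z ∉ E(B(0, ρ))`
  have hd0 := (restrictionDeriv_pos_le_one hB hΦ hd).1
  by_contra hlt
  push Not at hlt
  have hmem : hullExt Φ z ∈ ball (0 : ℂ) (‖(ρ : ℂ) * d‖ / 4) := by
    rw [mem_ball_zero_iff, norm_mul, norm_real, norm_real, Real.norm_of_nonneg hρ.le,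
      Real.norm_of_nonneg hd0.le]
    linarith
  obtain ⟨ζ, hζ, hζeq⟩ := hK hmem
  have hρζ : (ρ : ℂ) * ζ ∈ ball (0 : ℂ) ρ := by
    rw [mem_ball_zero_iff] at hζ ⊢
    rw [norm_mul, norm_real, Real.norm_of_nonneg hρ.le]
    nlinarith
  have heq : (ρ : ℂ) * ζ = z := hinj (hsub hρζ) hz hζeq
  have : ‖z‖ < ρ := by rw [← heq]; exact mem_ball_zero_iff.1 hρζ
  linarith

end Koebe


/-! ### The Loewner increment: `g(ζ) - ζ = 2u/ζ + O(u η)` off the small hull -/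

section Flow

variable {U : ℝ≥0 → ℝ} {u : ℝ≥0} {S : ℝ}
variable (hU : Continuous U) (hU0 : U 0 = 0) (hu : 0 < u) (hS : ∀ v : ℝ≥0, v ≤ u → |U v| ≤ S)
  (hρ₀ : 0 < ρ₀) (hη : stepSize S u ≤ ρ₀ / 4)
include hU hu hS hρ₀ hη

/-- **`|g_u(ζ) - ζ - 2u/ζ| ≤ 16 u η/ρ₀²` and `|g_u(ζ) - ζ| ≤ 8u/ρ₀` for `|ζ| ≥ ρ₀/2`** (integrated
Loewner equation: `g_u(ζ) - ζ = ∫₀ᵘ 2/(g_s ζ - U_s) ds`, and along the flow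
`|g_s ζ - U_s| ≥ ρ₀/4`, `|g_s ζ - ζ| + |U_s| ≤ η`). [cite: Lawler2005, Lemma 4.13 with (4.3)] -/
theorem norm_map_sub_sub_div_le {ζ : ℂ} (hζ : ρ₀ / 2 ≤ ‖ζ‖) :
    ‖map U u ζ - ζ - 2 * (u : ℂ) / ζ‖ ≤ 16 * u * stepSize S u / ρ₀ ^ 2 ∧
      ‖map U u ζ - ζ‖ ≤ 8 * u / ρ₀ := by
  have hη0 := (stepSize_pos hu hS).2
  have hS0 := (stepSize_pos hu hS).1
  have hsq : 0 < Real.sqrt u := Real.sqrt_pos.2 (NNReal.coe_pos.2 hu)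
  have hsqη : Real.sqrt u + S ≤ stepSize S u := by rw [stepSize]; linarith
  have hζη : stepSize S u ≤ ‖ζ‖ := by linarith
  obtain ⟨halive, hmove⟩ := alive_of_stepSize_le hU hu hS hζη
  have hζ0 : ζ ≠ 0 := by
    intro h; rw [h, norm_zero] at hζ; linarith
  -- the integrated equation
  have hint := map_eq_add_integral hU halive
  have hcont := continuousOn_vectorField_map hU halive
  -- pointwise bound on the integrand minus `2/ζ`
  have hpt : ∀ s ∈ Icc (0 : ℝ) u,
      ‖vectorField U s (map U s.toNNReal ζ) - 2 / ζ‖ ≤ 16 * stepSize S u / ρ₀ ^ 2 := by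
    intro s hs
    have hsu : s.toNNReal ≤ u := by
      rw [← NNReal.coe_le_coe, Real.coe_toNNReal s hs.1]; exact hs.2
    obtain ⟨hfar, hmv⟩ := hmove _ hsu
    have hmv' : ‖map U s.toNNReal ζ - ζ‖ ≤ Real.sqrt u := by
      refine hmv.trans ?_
      rw [Real.coe_toNNReal s hs.1]
      have : 2 / (2 * Real.sqrt u) * s ≤ 2 / (2 * Real.sqrt u) * u :=
        mul_le_mul_of_nonneg_left hs.2 (by positivity)
      refine this.trans (le_of_eq ?_)
      have hu' : (u : ℝ) = Real.sqrt u * Real.sqrt u := (Real.mul_self_sqrt u.coe_nonneg).symm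
      field_simp
      nlinarith [hu']
    have hUs : |U s.toNNReal| ≤ S := hS _ hsu
    set gs := map U s.toNNReal ζ with hgs
    have hden : ρ₀ / 4 ≤ ‖gs - U s.toNNReal‖ := by
      have h1 : ‖ζ‖ ≤ ‖gs - U s.toNNReal‖ + ‖gs - ζ‖ + ‖((U s.toNNReal : ℝ) : ℂ)‖ := by
        calc ‖ζ‖ = ‖(gs - U s.toNNReal) - (gs - ζ) + (U s.toNNReal : ℂ)‖ := by ring_nf
          _ ≤ ‖(gs - U s.toNNReal) - (gs - ζ)‖ + ‖((U s.toNNReal : ℝ) : ℂ)‖ := norm_add_le _ _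
          _ ≤ ‖gs - U s.toNNReal‖ + ‖gs - ζ‖ + ‖((U s.toNNReal : ℝ) : ℂ)‖ := by
              linarith [norm_sub_le (gs - U s.toNNReal) (gs - ζ)]
      rw [norm_real, Real.norm_eq_abs] at h1
      rw [stepSize] at hζη hη
      linarith
    have hden0 : gs - U s.toNNReal ≠ 0 := by
      intro h; rw [h, norm_zero] at hden; linarith
    rw [vectorField_apply]
    have hnum : ‖ζ - (gs - U s.toNNReal)‖ ≤ stepSize S u := by
      calc ‖ζ - (gs - U s.toNNReal)‖ = ‖-(gs - ζ) + (U s.toNNReal : ℂ)‖ := by ring_nf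
        _ ≤ ‖-(gs - ζ)‖ + ‖((U s.toNNReal : ℝ) : ℂ)‖ := norm_add_le _ _
        _ ≤ Real.sqrt u + S := by rw [norm_neg, norm_real, Real.norm_eq_abs]; linarith
        _ ≤ stepSize S u := hsqη
    have hrew : (2 : ℂ) / (gs - U s.toNNReal) - 2 / ζ = 2 * (ζ - (gs - U s.toNNReal)) / ((gs - U s.toNNReal) * ζ) := by
      field_simp
    rw [hrew, norm_div, norm_mul, norm_mul, Complex.norm_two]
    rw [div_le_div_iff₀ (by positivity) (by positivity)]
    have hρζ : ρ₀ / 2 * (ρ₀ / 4) ≤ ‖gs - ↑(U s.toNNReal)‖ * ‖ζ‖ := by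
      have := mul_le_mul hden hζ (by positivity) (norm_nonneg _)
      linarith
    nlinarith [hnum, norm_nonneg (ζ - (gs - U s.toNNReal)), hη0.le]
  -- integrate
  have hsub : map U u ζ - ζ - 2 * (u : ℂ) / ζ =
      ∫ s in (0 : ℝ)..u, (vectorField U s (map U s.toNNReal ζ) - 2 / ζ) := by
    rw [intervalIntegral.integral_sub (hcont.intervalIntegrable_of_Icc u.coe_nonneg)
      intervalIntegrable_const, intervalIntegral.integral_const, hint]
    simp only [sub_zero, real_smul]
    ring
  have hI : ‖map U u ζ - ζ - 2 * (u : ℂ) / ζ‖ ≤ 16 * u * stepSize S u / ρ₀ ^ 2 := by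
    rw [hsub]
    have h := intervalIntegral.norm_integral_le_of_norm_le_const (a := (0 : ℝ)) (b := (u : ℝ))
      (C := 16 * stepSize S u / ρ₀ ^ 2) (f := fun s ↦ vectorField U s (map U s.toNNReal ζ) - 2 / ζ)
      (fun s hs ↦ hpt s (by rw [uIoc_of_le u.coe_nonneg] at hs; exact ⟨hs.1.le, hs.2⟩))
    simp only [sub_zero, abs_of_nonneg u.coe_nonneg] at h
    calc _ ≤ 16 * stepSize S u / ρ₀ ^ 2 * u := h
      _ = 16 * u * stepSize S u / ρ₀ ^ 2 := by ring
  refine ⟨hI, ?_⟩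
  have h2 : ‖2 * (u : ℂ) / ζ‖ ≤ 4 * u / ρ₀ := by
    rw [norm_div, norm_mul, Complex.norm_two, Complex.norm_of_nonneg u.coe_nonneg, div_le_div_iff₀ (norm_pos_iff.2 hζ0) hρ₀]
    nlinarith [u.coe_nonneg]
  have h3 : 16 * u * stepSize S u / ρ₀ ^ 2 ≤ 4 * u / ρ₀ := by
    rw [div_le_div_iff₀ (by positivity) hρ₀]
    have h4 : stepSize S u * 4 ≤ ρ₀ := by linarith
    have := mul_le_mul_of_nonneg_left h4 (by positivity : 0 ≤ 4 * (u : ℝ) * ρ₀)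
    nlinarith [this]
  have h8 : 4 * (u : ℝ) / ρ₀ + 4 * u / ρ₀ = 8 * u / ρ₀ := by ring
  calc ‖map U u ζ - ζ‖ = ‖(map U u ζ - ζ - 2 * (u : ℂ) / ζ) + 2 * (u : ℂ) / ζ‖ := by ring_nf
    _ ≤ ‖map U u ζ - ζ - 2 * (u : ℂ) / ζ‖ + ‖2 * (u : ℂ) / ζ‖ := norm_add_le _ _
    _ ≤ 8 * u / ρ₀ := by linarith

end Flow


/-! ### Bounds for `h' = hmapT Φ' (U u)` near the circle and the identity on `|ζ| = ρ` -/

section Circle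

variable {U : ℝ≥0 → ℝ} {u : ℝ≥0} {S : ℝ}
  {Φ' : ConformalEquiv (upperHalfPlaneSet \ slidHull U B u) upperHalfPlaneSet}
variable (hB : IsStarHull B) (hΦ : IsRestrictionMap B Φ) (hd : HasRestrictionDeriv B Φ d)
  (hU : Continuous U) (hU0 : U 0 = 0) (hu : 0 < u) (hS : ∀ v : ℝ≥0, v ≤ u → |U v| ≤ S)
  (hρ₀ : 0 < ρ₀) (hBρ : Disjoint (ball (0 : ℂ) (8 * ρ₀)) B)
  (hη : stepSize S u ≤ d * ρ₀ / 1000)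
  (hΦ' : IsRestrictionMap (slidHull U B u) Φ')

/-- **The capacity increment `a = hcap` of the one-step map `φ`** (the coefficient of
`1/(w - w₀)` in the hydrodynamic expansion of `φ = h' ∘ g ∘ h⁻¹` at `w₀ = -L`), computed from the
reflected map `phiStep Φ Φ' r`; the parameter `r` only selects the radius used to certify
`IsHydrodynamicAt` (the maps for two radii agree off the larger disc, so the value is the same for
all admissible `r`, cf. `IsHydrodynamicAt.hcapAt_congr`); below `r = 2η`, `η = stepSize S u`.
[cite: Lawler2005, §4.6.1 (proof of Prop. 4.40)] -/
def stepCap (Φ : ConformalEquiv (upperHalfPlaneSet \ B) upperHalfPlaneSet)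
    (Φ' : ConformalEquiv (upperHalfPlaneSet \ slidHull U B u) upperHalfPlaneSet) (r : ℝ) : ℝ :=
  hcapAt (phiStep Φ Φ' r) ((-hullShift Φ).re)

include hB hΦ hd hu hS hρ₀ hη in
/-- Consequences of the smallness hypothesis `η ≤ d ρ₀/1000` (with `0 < d ≤ 1`, `η = S + 4√u`):
`η ≤ ρ₀/1000`, `u ≤ η²/16`. [folklore] -/
theorem stepSize_small : 0 < d ∧ d ≤ 1 ∧ 0 < stepSize S u ∧ stepSize S u ≤ ρ₀ / 1000 ∧
    (u : ℝ) ≤ stepSize S u ^ 2 / 16 ∧ (u : ℝ) ≤ ρ₀ ^ 2 / 10 ^ 6 := by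
  obtain ⟨hd0, hd1⟩ := restrictionDeriv_pos_le_one hB hΦ hd
  obtain ⟨hS0, hη0⟩ := stepSize_pos hu hS
  have h1 : stepSize S u ≤ ρ₀ / 1000 :=
    hη.trans (div_le_div_of_nonneg_right (by nlinarith) (by norm_num))
  have h2 : (u : ℝ) ≤ stepSize S u ^ 2 / 16 := by
    have hsq : 4 * Real.sqrt u ≤ stepSize S u := by rw [stepSize]; linarith
    have := pow_le_pow_left₀ (by positivity) hsq 2
    rw [mul_pow, Real.sq_sqrt u.coe_nonneg] at this
    linarith
  refine ⟨hd0, hd1, hη0, h1, h2, h2.trans ?_⟩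
  have := pow_le_pow_left₀ hη0.le h1 2
  nlinarith

include hB hΦ hd hU hU0 hu hS hρ₀ hBρ hη hΦ' in
/-- `|E_{B'}'(y)| ≤ 2` on `B(0, 3ρ₀)` (Schwarz–Pick for the reflected map of the slid hull, which
misses `B(0, 6ρ₀)`). [folklore] -/
theorem norm_deriv_hullExt_slid_le_two {y : ℂ} (hy : y ∈ ball (0 : ℂ) (3 * ρ₀)) :
    ‖deriv (hullExt Φ') y‖ ≤ 2 := by
  obtain ⟨-, -, -, hη1, -⟩ := stepSize_small hB hΦ hd hu hS hρ₀ hη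
  have hη' : stepSize S u ≤ ρ₀ := by linarith
  have hdisj := disjoint_ball_slidHull hU hu hS hBρ hη'
  have hB' := isStarHull_slidHull_step hB hU hU0 hS hρ₀ hBρ hη'
  refine norm_deriv_hullExt_le_two hB'.isBoundedHull hΦ' (x := 0) (r := 2 * (3 * ρ₀)) (by simpa using hdisj) ?_
  simpa using hy

include hB hΦ hd hU hU0 hu hS hρ₀ hBρ hη hΦ' in
/-- `B(0, 6ρ₀) ⊆ symmDomain B'` and `E_{B'}` is differentiable there. [folklore] -/
theorem ball_subset_symmDomain_slid : ball (0 : ℂ) (6 * ρ₀) ⊆ symmDomain (slidHull U B u) ∧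
    DifferentiableOn ℂ (hullExt Φ') (ball (0 : ℂ) (6 * ρ₀)) := by
  obtain ⟨-, -, -, hη1, -⟩ := stepSize_small hB hΦ hd hu hS hρ₀ hη
  have hη' : stepSize S u ≤ ρ₀ := by linarith
  have hdisj := disjoint_ball_slidHull hU hu hS hBρ hη'
  have hB' := isStarHull_slidHull_step hB hU hU0 hS hρ₀ hBρ hη'
  have hsub : ball (0 : ℂ) (6 * ρ₀) ⊆ symmDomain (slidHull U B u) := by
    have := ball_subset_symmDomain (B := slidHull U B u) (x := 0) (r := 2 * (3 * ρ₀)) (by simpa using hdisj)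
    simpa [show 2 * (3 * ρ₀) = 6 * ρ₀ by ring] using this
  exact ⟨hsub, (differentiableOn_hullExt hB'.isBoundedHull hΦ').mono hsub⟩

include hB hΦ hd hU hU0 hu hS hρ₀ hBρ hη hΦ' in
/-- **`|E_{B'}''(y)| ≤ 2/ρ₀` on `B(0, 2ρ₀)`** (Cauchy estimate on the circle `|w - y| = ρ₀`, inside
`B(0, 3ρ₀)` where `|E_{B'}'| ≤ 2`). [folklore] -/
theorem norm_deriv_deriv_hullExt_slid_le {y : ℂ} (hy : y ∈ ball (0 : ℂ) (2 * ρ₀)) :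
    ‖deriv (deriv (hullExt Φ')) y‖ ≤ 2 / ρ₀ := by
  obtain ⟨hsub, hdiff⟩ := ball_subset_symmDomain_slid hB hΦ hd hU hU0 hu hS hρ₀ hBρ hη hΦ'
  have hcl : closedBall y ρ₀ ⊆ ball (0 : ℂ) (3 * ρ₀) := by
    intro w hw
    rw [mem_closedBall, dist_eq_norm] at hw
    rw [mem_ball_zero_iff] at hy ⊢
    calc ‖w‖ = ‖(w - y) + y‖ := by ring_nf
      _ ≤ ‖w - y‖ + ‖y‖ := norm_add_le _ _
      _ < 3 * ρ₀ := by linarith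
  have hd' : DifferentiableOn ℂ (deriv (hullExt Φ')) (ball (0 : ℂ) (6 * ρ₀)) :=
    ((hdiff.analyticOnNhd isOpen_ball).deriv).differentiableOn
  refine Complex.norm_deriv_le_of_forall_mem_sphere_norm_le hρ₀ ?_ fun w hw ↦ ?_
  · refine DifferentiableOn.diffContOnCl ?_
    rw [closure_ball y hρ₀.ne']
    exact hd'.mono (hcl.trans (ball_subset_ball (by linarith)))
  · exact norm_deriv_hullExt_slid_le_two hB hΦ hd hU hU0 hu hS hρ₀ hBρ hη hΦ'
      (hcl (sphere_subset_closedBall hw))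

include hB hΦ hd hU hU0 hu hS hρ₀ hBρ hη hΦ' in
/-- `h' = hmapT Φ' (U u)` has derivative `E_{B'}'(y - U_u)` at every `y ∈ B̄(0, 5ρ₀)`. [folklore] -/
theorem hasDerivAt_hmapT {y : ℂ} (hy : ‖y‖ ≤ 5 * ρ₀) :
    HasDerivAt (hmapT Φ' (U u)) (deriv (hullExt Φ') (y - U u)) y := by
  obtain ⟨hsub, hdiff⟩ := ball_subset_symmDomain_slid hB hΦ hd hU hU0 hu hS hρ₀ hBρ hη hΦ'
  obtain ⟨-, -, hη0, hη1, -⟩ := stepSize_small hB hΦ hd hu hS hρ₀ hη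
  have hUu : |U u| ≤ stepSize S u := by
    have := hS u le_rfl
    rw [stepSize]; have := Real.sqrt_nonneg (u : ℝ); linarith
  have hyU : y - U u ∈ ball (0 : ℂ) (6 * ρ₀) := by
    rw [mem_ball_zero_iff]
    calc ‖y - U u‖ ≤ ‖y‖ + ‖((U u : ℝ) : ℂ)‖ := norm_sub_le _ _
      _ < 6 * ρ₀ := by rw [norm_real, Real.norm_eq_abs]; linarith
  have h1 : HasDerivAt (hullExt Φ') (deriv (hullExt Φ') (y - U u)) (y - U u) :=
    ((hdiff.differentiableAt (isOpen_ball.mem_nhds hyU))).hasDerivAt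
  have h2 := h1.comp_sub_const y (U u : ℂ)
  have h3 := (h2.sub_const (hullShift Φ')).add_const ((U u : ℝ) : ℂ)
  have hfun : hmapT Φ' (U u) = fun x ↦ hullExt Φ' (x - U u) - hullShift Φ' + U u := by
    funext x; rfl
  rw [hfun]
  exact h3

include hB hΦ hd hU hU0 hu hS hρ₀ hBρ hη hΦ' in
/-- **Second-order Taylor bound for `h'`**: for `|ζ| ≤ ρ₀` and `|y - ζ| ≤ ρ₀/8`,
`|h'(y) - h'(ζ) - h''(ζ)(y - ζ)| ≤ (2/ρ₀)|y - ζ|²` (mean value inequality twice).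
[folklore] -/
theorem norm_hmapT_taylor_le {ζ y : ℂ} (hζ : ‖ζ‖ ≤ ρ₀) (hy : ‖y - ζ‖ ≤ ρ₀ / 8) :
    ‖hmapT Φ' (U u) y - hmapT Φ' (U u) ζ - deriv (hullExt Φ') (ζ - U u) * (y - ζ)‖ ≤
      2 / ρ₀ * ‖y - ζ‖ ^ 2 := by
  obtain ⟨hsub, hdiff⟩ := ball_subset_symmDomain_slid hB hΦ hd hU hU0 hu hS hρ₀ hBρ hη hΦ'
  obtain ⟨-, -, hη0, hη1, -⟩ := stepSize_small hB hΦ hd hu hS hρ₀ hη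
  have hUu : |U u| ≤ stepSize S u := by
    have := hS u le_rfl
    rw [stepSize]; have := Real.sqrt_nonneg (u : ℝ); linarith
  set s : Set ℂ := closedBall ζ ‖y - ζ‖ with hs
  have hsconv : Convex ℝ s := convex_closedBall _ _
  have hζs : ζ ∈ s := mem_closedBall_self (norm_nonneg _)
  have hys : y ∈ s := by rw [hs, mem_closedBall, dist_eq_norm]
  have hs5 : ∀ w ∈ s, ‖w‖ ≤ 5 * ρ₀ := fun w hw ↦ by
    rw [hs, mem_closedBall, dist_eq_norm] at hw
    calc ‖w‖ = ‖(w - ζ) + ζ‖ := by ring_nf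
      _ ≤ ‖w - ζ‖ + ‖ζ‖ := norm_add_le _ _
      _ ≤ 5 * ρ₀ := by linarith
  have hs2 : ∀ w ∈ s, w - U u ∈ ball (0 : ℂ) (2 * ρ₀) := fun w hw ↦ by
    rw [hs, mem_closedBall, dist_eq_norm] at hw
    rw [mem_ball_zero_iff]
    calc ‖w - U u‖ = ‖(w - ζ) + ζ - U u‖ := by ring_nf
      _ ≤ ‖(w - ζ) + ζ‖ + ‖((U u : ℝ) : ℂ)‖ := norm_sub_le _ _
      _ ≤ ‖w - ζ‖ + ‖ζ‖ + ‖((U u : ℝ) : ℂ)‖ := by linarith [norm_add_le (w - ζ) ζ]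
      _ < 2 * ρ₀ := by rw [norm_real, Real.norm_eq_abs]; linarith
  set D1 : ℂ → ℂ := fun w ↦ deriv (hullExt Φ') (w - U u) with hD1
  have hder : ∀ w ∈ s, HasDerivAt (hmapT Φ' (U u)) (D1 w) w := fun w hw ↦
    hasDerivAt_hmapT hB hΦ hd hU hU0 hu hS hρ₀ hBρ hη hΦ' (hs5 w hw)
  -- the derivative `D1` is `(2/ρ₀)`-Lipschitz on `s`
  have hd' : DifferentiableOn ℂ (deriv (hullExt Φ')) (ball (0 : ℂ) (6 * ρ₀)) :=
    ((hdiff.analyticOnNhd isOpen_ball).deriv).differentiableOn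
  have hD1der : ∀ w ∈ s, HasDerivAt D1 (deriv (deriv (hullExt Φ')) (w - U u)) w := fun w hw ↦ by
    have hw6 : w - U u ∈ ball (0 : ℂ) (6 * ρ₀) := ball_subset_ball (by linarith) (hs2 w hw)
    exact ((hd'.differentiableAt (isOpen_ball.mem_nhds hw6)).hasDerivAt).comp_sub_const w (U u : ℂ)
  have hD1bd : ∀ w ∈ s, ‖D1 w - D1 ζ‖ ≤ 2 / ρ₀ * ‖y - ζ‖ := fun w hw ↦ by
    have := hsconv.norm_image_sub_le_of_norm_deriv_le (f := D1) (C := 2 / ρ₀)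
      (fun w hw ↦ (hD1der w hw).differentiableAt)
      (fun w hw ↦ by rw [(hD1der w hw).deriv]; exact norm_deriv_deriv_hullExt_slid_le hB hΦ hd hU hU0 hu hS hρ₀ hBρ hη hΦ' (hs2 w hw))
      hζs hw
    refine this.trans (mul_le_mul_of_nonneg_left ?_ (by positivity))
    rw [hs, mem_closedBall, dist_eq_norm] at hw; exact hw
  -- mean value inequality for `G(w) = h'(w) - D1(ζ) w`
  set G : ℂ → ℂ := fun w ↦ hmapT Φ' (U u) w - D1 ζ * w with hG
  have hGder : ∀ w ∈ s, HasDerivAt G (D1 w - D1 ζ) w := fun w hw ↦ by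
    have := (hder w hw).sub ((hasDerivAt_id w).const_mul (D1 ζ))
    rw [mul_one] at this
    exact this
  have hMVT := hsconv.norm_image_sub_le_of_norm_deriv_le (f := G) (C := 2 / ρ₀ * ‖y - ζ‖)
    (fun w hw ↦ (hGder w hw).differentiableAt)
    (fun w hw ↦ by rw [(hGder w hw).deriv]; exact hD1bd w hw) hζs hys
  have hrew : G y - G ζ = hmapT Φ' (U u) y - hmapT Φ' (U u) ζ - deriv (hullExt Φ') (ζ - U u) * (y - ζ) := by
    simp only [hG, hD1]; ring
  rw [hrew] at hMVT
  calc _ ≤ 2 / ρ₀ * ‖y - ζ‖ * ‖y - ζ‖ := hMVT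
    _ = 2 / ρ₀ * ‖y - ζ‖ ^ 2 := by ring

include hB hΦ hd hU hU0 hu hS hρ₀ hBρ hη hΦ' in
/-- **The conjugation identity on the circle**: `φ(h(ζ)) = h'(g(ζ))` for `ρ₀/2 ≤ |ζ| ≤ ρ₀`
(the three cases `Im ζ > 0`, `Im ζ < 0`, `ζ = ±|ζ|` of `LoewnerImageStep`). [folklore] -/
theorem phiStep_hmap_circle {ζ : ℂ} (hζ : ρ₀ / 2 ≤ ‖ζ‖) (hζ1 : ‖ζ‖ ≤ ρ₀) :
    phiStep Φ Φ' (2 * stepSize S u) (hmap Φ ζ) = hmapT Φ' (U u) (map U u ζ) := by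
  obtain ⟨hd0, hd1, hη0, hη1, -⟩ := stepSize_small hB hΦ hd hu hS hρ₀ hη
  have hη' : stepSize S u ≤ ρ₀ := by linarith
  have hζ4 : ζ ∈ ball (0 : ℂ) (4 * ρ₀) := mem_ball_zero_iff.2 (by linarith)
  have hζB : ζ ∉ B := fun h ↦ by
    have := le_norm_of_mem hBρ h; linarith
  have hEz : d * (ρ₀ / 2) / 4 ≤ ‖hullExt Φ ζ‖ :=
    norm_hullExt_ge hB hΦ hd hρ₀ hBρ (by positivity) (by linarith) hζ4 hζ
  have hr : 2 * stepSize S u < ‖hullExt Φ ζ‖ := by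
    have : 2 * stepSize S u < d * (ρ₀ / 2) / 4 := by nlinarith
    linarith
  rcases lt_trichotomy ζ.im 0 with him | him | him
  · have hsymm : ζ ∈ symmDomain B := by
      have := ball_subset_symmDomain (B := B) (x := 0) (r := 8 * ρ₀) (by simpa using hBρ)
      rw [ofReal_zero] at this
      exact this (ball_subset_ball (by linarith) hζ4)
    exact phiStep_hmap_of_im_neg hB hΦ hU hU0 hu hS hρ₀ hBρ hη' hΦ' hsymm him hr
  · have hζre : ((ζ.re : ℝ) : ℂ) = ζ := by
      apply Complex.ext <;> simp [him]
    have halive := (alive_of_stepSize_le hU hu hS (z := ζ) (by linarith)).1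
    have := phiStep_hmap_of_real hB hΦ hU hU0 hu hS hρ₀ hBρ hη' hΦ' (x := ζ.re)
      (by rwa [hζre]) (by rwa [hζre]) (by rwa [hζre])
    rwa [hζre] at this
  · exact phiStep_hmap_of_im_pos hB hΦ ⟨him, hζB⟩ _

omit hB hΦ hρ₀ hBρ in
/-- The algebraic identity behind the circle bound. [folklore] -/
private theorem circle_algebra (Δ φh h hT hTg a E D1 gζ ζ twou : ℂ) (hconj : φh = hTg)
    (hΔ : Δ = hT - h) :
    Δ - (a / E - D1 * (twou / ζ)) =
      (φh - h - a / E) - (hTg - hT - D1 * (gζ - ζ)) - D1 * (gζ - ζ - twou / ζ) := by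
  subst hconj hΔ; ring

include hB hΦ hd hU hU0 hu hS hρ₀ hBρ hη hΦ' in
/-- **The identity on the circle** `|ζ| = ρ`, `ρ₀/2 ≤ ρ ≤ ρ₀` (proof of Lawler's Prop. 4.40):

  `|[h'(ζ) - h(ζ)] - [a/E_B(ζ) - E_{B'}'(ζ - U_u) · 2u/ζ]| ≤ 192 a η/(d² ρ²) + 32 u η/ρ₀² + 128 u²/ρ₀³`,

where `h = hmap Φ`, `h' = hmapT Φ' (U u)`, `η = stepSize S u`, `a = stepCap Φ Φ' (2η) ≥ 0`: from
the expansion `φ(w) = w + a/(w - w₀) + O(a η/|w - w₀|²)` at `w = h(ζ)` (`w - w₀ = E_B(ζ)`,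
`|E_B(ζ)| ≥ dρ/4`), the conjugation `φ(h ζ) = h'(g ζ)`, the Taylor bound for `h'` between `ζ`
and `g ζ`, and `g ζ - ζ = 2u/ζ + O(uη/ρ₀²)`.
[cite: Lawler2005, §4.6.1 proof of Prop. 4.40; LawlerSchrammWerner2003Restriction §5 (5.2)] -/
theorem norm_sub_hmap_circle_le {ρ : ℝ} (hρ : ρ₀ / 2 ≤ ρ) (hρ1 : ρ ≤ ρ₀) {ζ : ℂ} (hζ : ‖ζ‖ = ρ) :
    0 ≤ stepCap Φ Φ' (2 * stepSize S u) ∧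
    ‖(hmapT Φ' (U u) ζ - hmap Φ ζ) - ((stepCap Φ Φ' (2 * stepSize S u) : ℂ) / hullExt Φ ζ -
        deriv (hullExt Φ') (ζ - U u) * (2 * (u : ℂ) / ζ))‖ ≤
      192 * stepCap Φ Φ' (2 * stepSize S u) * stepSize S u / (d ^ 2 * ρ ^ 2) +
        32 * u * stepSize S u / ρ₀ ^ 2 + 128 * u ^ 2 / ρ₀ ^ 3 := by
  obtain ⟨hd0, hd1, hη0, hη1, huη, huρ⟩ := stepSize_small hB hΦ hd hu hS hρ₀ hη
  have hη' : stepSize S u ≤ ρ₀ := by linarith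
  have hρ0 : 0 < ρ := by linarith
  have hζ' : ρ₀ / 2 ≤ ‖ζ‖ := hζ ▸ hρ
  have hζ1 : ‖ζ‖ ≤ ρ₀ := hζ ▸ hρ1
  have hζ0 : ζ ≠ 0 := by intro h; rw [h, norm_zero] at hζ'; linarith
  have hζ4 : ζ ∈ ball (0 : ℂ) (4 * ρ₀) := mem_ball_zero_iff.2 (by linarith)
  set a : ℝ := stepCap Φ Φ' (2 * stepSize S u) with ha
  set η : ℝ := stepSize S u with hηdef
  have hydro := isHydrodynamicAt_phiStep hB hΦ hU hU0 hu hS hρ₀ hBρ hη' hΦ'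
  have ha0 : 0 ≤ a := hydro.hcapAt_nonneg
  refine ⟨ha0, ?_⟩
  -- Koebe lower bound
  have hEz : d * ρ / 4 ≤ ‖hullExt Φ ζ‖ :=
    norm_hullExt_ge hB hΦ hd hρ₀ hBρ hρ0 (by linarith) hζ4 hζ.ge
  have hEpos : 0 < ‖hullExt Φ ζ‖ := lt_of_lt_of_le (by positivity) hEz
  -- the expansion of `φ` at `w = h ζ`, `w - w₀ = E ζ`
  have hL : ((hullShift Φ).re : ℂ) = hullShift Φ := by
    apply Complex.ext <;> simp [hullShift_im hB.isBoundedHull hΦ]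
  have hwx : hmap Φ ζ - (((-hullShift Φ).re : ℝ) : ℂ) = hullExt Φ ζ := by
    rw [hmap, neg_re, ofReal_neg, hL]; ring
  have h2r : 2 * (2 * η) ≤ ‖hmap Φ ζ - (((-hullShift Φ).re : ℝ) : ℂ)‖ := by
    rw [hwx]
    have : 2 * (2 * η) ≤ d * ρ / 4 := by nlinarith
    linarith
  have hexp := hydro.norm_sub_sub_div_le' h2r
  rw [hwx] at hexp
  change ‖phiStep Φ Φ' (2 * η) (hmap Φ ζ) - hmap Φ ζ - (a : ℂ) / hullExt Φ ζ‖ ≤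
    6 * a * (2 * η) / ‖hullExt Φ ζ‖ ^ 2 at hexp
  -- conjugation, Loewner increment, Taylor
  have hconj := phiStep_hmap_circle hB hΦ hd hU hU0 hu hS hρ₀ hBρ hη hΦ' hζ' hζ1
  obtain ⟨hLR, hmv⟩ := norm_map_sub_sub_div_le hU hu hS hρ₀ (by linarith) hζ'
  have hmv' : ‖map U u ζ - ζ‖ ≤ ρ₀ / 8 := by
    refine hmv.trans ?_
    rw [div_le_div_iff₀ hρ₀ (by norm_num)]
    nlinarith
  have hT := norm_hmapT_taylor_le hB hΦ hd hU hU0 hu hS hρ₀ hBρ hη hΦ' hζ1 hmv'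
  have hD1 : ‖deriv (hullExt Φ') (ζ - U u)‖ ≤ 2 := by
    refine norm_deriv_hullExt_slid_le_two hB hΦ hd hU hU0 hu hS hρ₀ hBρ hη hΦ' ?_
    have hUu : |U u| ≤ η := by
      have := hS u le_rfl; rw [hηdef, stepSize]; have := Real.sqrt_nonneg (u : ℝ); linarith
    rw [mem_ball_zero_iff]
    calc ‖ζ - U u‖ ≤ ‖ζ‖ + ‖((U u : ℝ) : ℂ)‖ := norm_sub_le _ _
      _ < 3 * ρ₀ := by rw [norm_real, Real.norm_eq_abs]; linarith
  rw [circle_algebra _ _ _ _ _ _ _ _ (map U u ζ) ζ _ hconj rfl]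
  -- the three error terms
  have e1 : ‖phiStep Φ Φ' (2 * η) (hmap Φ ζ) - hmap Φ ζ - (a : ℂ) / hullExt Φ ζ‖ ≤
      192 * a * η / (d ^ 2 * ρ ^ 2) := by
    refine hexp.trans ?_
    rw [div_le_div_iff₀ (by positivity) (by positivity)]
    have h16 : d ^ 2 * ρ ^ 2 ≤ 16 * ‖hullExt Φ ζ‖ ^ 2 := by
      have hsq := mul_le_mul hEz hEz (by positivity) (norm_nonneg _)
      nlinarith [hsq]
    have : 6 * a * (2 * η) * (d ^ 2 * ρ ^ 2) ≤ 6 * a * (2 * η) * (16 * ‖hullExt Φ ζ‖ ^ 2) :=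
      mul_le_mul_of_nonneg_left h16 (by positivity)
    nlinarith
  have e2 : ‖hmapT Φ' (U u) (map U u ζ) - hmapT Φ' (U u) ζ -
      deriv (hullExt Φ') (ζ - U u) * (map U u ζ - ζ)‖ ≤ 128 * u ^ 2 / ρ₀ ^ 3 := by
    refine hT.trans ?_
    have := pow_le_pow_left₀ (norm_nonneg _) hmv 2
    calc 2 / ρ₀ * ‖map U u ζ - ζ‖ ^ 2 ≤ 2 / ρ₀ * (8 * u / ρ₀) ^ 2 :=
          mul_le_mul_of_nonneg_left this (by positivity)
      _ = 128 * u ^ 2 / ρ₀ ^ 3 := by field_simp; ring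
  have e3 : ‖deriv (hullExt Φ') (ζ - U u) * (map U u ζ - ζ - 2 * (u : ℂ) / ζ)‖ ≤
      32 * u * η / ρ₀ ^ 2 := by
    rw [norm_mul]
    calc _ ≤ 2 * (16 * u * η / ρ₀ ^ 2) := mul_le_mul hD1 hLR (norm_nonneg _) (by norm_num)
      _ = 32 * u * η / ρ₀ ^ 2 := by ring
  calc _ ≤ ‖phiStep Φ Φ' (2 * η) (hmap Φ ζ) - hmap Φ ζ - (a : ℂ) / hullExt Φ ζ -
          (hmapT Φ' (U u) (map U u ζ) - hmapT Φ' (U u) ζ - deriv (hullExt Φ') (ζ - U u) * (map U u ζ - ζ))‖ +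
        ‖deriv (hullExt Φ') (ζ - U u) * (map U u ζ - ζ - 2 * (u : ℂ) / ζ)‖ := norm_sub_le _ _
    _ ≤ (192 * a * η / (d ^ 2 * ρ ^ 2) + 128 * u ^ 2 / ρ₀ ^ 3) + 32 * u * η / ρ₀ ^ 2 := by
        gcongr
        exact (norm_sub_le _ _).trans (add_le_add e1 e2)
    _ = _ := by ring

end Circle
end Loewner

end Literature.Probability.RandomPlanarGeometry
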